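import Mathlib
import Summits.KontsevichZagierPeriods.Zeta5Search.CatalanTwoAdicSeries
import HarnessLib

/-!
# Catalan box family — the transfer constant `Σ_{ν≥1} t_ν/ν = 4` holds in `ℚ₂`

HONEST FRAMING: systematic search; no irrationality claim unless certified.

Cell `pub-zeta5`, family-designer seat `fam-catalan` (`families/catalan/TWOADIC.md` §8, item K5a).  The formal transfer of the
partial-fraction reduction of the Catalan box forms from ℝ to `ℚ₂` uses exactly ONE numerical constant: `Σ_{ν≥1} t_ν/ν = 4`
(`t_ν = B(ν+1,½)` the Beta weights).  By `CatalanTwoAdicSeries.tB_sum_div` the partial sums are `4 − 2t_N` as rationals, so the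
constant is `4` in every completion of `ℚ` in which `t_N → 0`.  In ℝ this is `t_N ~ √(π/N) → 0`; here we prove the 2-adic statement
(`hasSum_tB_div_two_adic`): `‖t_N‖₂ = 2^{−(2N+1−s₂(N))} ≤ 2^{−(N+1)} → 0`, the series is summable in `ℚ_[2]` and its sum is `4`.
Nothing here concerns `G` or irrationality.  0 sorry.
-/

open Finset Filter

namespace Summit.KontsevichZagierPeriods.Zeta5Search.CatalanTwoAdicSeries

open Summit.KontsevichZagierPeriods.Zeta5Search.CatalanQSum (padicValNat_two_factorial)

/-- `v₂(t_N) ≥ N + 1` (from `v₂(t_N) = 2N+1−s₂(N)` and `s₂(N) ≤ N`). -/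
theorem padicValRat_two_tB_ge (N : ℕ) : (N : ℤ) + 1 ≤ padicValRat 2 (tB N) := by
  rw [padicValRat_two_tB]
  have h := padicValNat_two_factorial N
  have h0 : (0 : ℤ) ≤ (padicValNat 2 N.factorial : ℤ) := by positivity
  linarith

/-- `‖t_N‖₂ ≤ (1/2)^(N+1)`. -/
theorem norm_tB_le (N : ℕ) : ‖((tB N : ℚ) : ℚ_[2])‖ ≤ ((1 : ℝ) / 2) ^ (N + 1) := by
  rw [Padic.eq_padicNorm, padicNorm.eq_zpow_of_nonzero (tB_ne_zero N)]
  push_cast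
  have hν : ((1 : ℝ) / 2) ^ (N + 1) = (2 : ℝ) ^ (-((N : ℤ) + 1)) := by
    rw [zpow_neg, one_div, inv_pow, ← zpow_natCast]; push_cast; rfl
  rw [hν]
  exact zpow_le_zpow_right₀ (by norm_num) (by have := padicValRat_two_tB_ge N; linarith)

/-- `t_N → 0` in `ℚ₂`. -/
theorem tendsto_tB_two_adic : Tendsto (fun N => ((tB N : ℚ) : ℚ_[2])) atTop (nhds 0) := by
  rw [tendsto_zero_iff_norm_tendsto_zero]
  have hb : Tendsto (fun N : ℕ => ((1 : ℝ) / 2) ^ (N + 1)) atTop (nhds 0) := by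
    have := (tendsto_pow_atTop_nhds_zero_of_lt_one (by norm_num : (0 : ℝ) ≤ 1 / 2) (by norm_num)).mul_const
      ((1 : ℝ) / 2)
    simpa [pow_succ] using this
  exact squeeze_zero (fun N => norm_nonneg _) norm_tB_le hb

/-- The general term `t_{ν+1}/(ν+1)` equals `2t_ν − 2t_{ν+1}` (telescoping identity), hence has small 2-adic norm. -/
theorem norm_tB_div_le (ν : ℕ) : ‖((tB (ν + 1) / (ν + 1 : ℚ) : ℚ) : ℚ_[2])‖ ≤ ((1 : ℝ) / 2) ^ (ν + 1) := by
  rw [tB_div_eq_telescope]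
  push_cast
  have h2 : ‖(2 : ℚ_[2])‖ = 1 / 2 := by
    have := @Padic.norm_p 2 _; push_cast at this; rw [this]; norm_num
  calc ‖(2 : ℚ_[2]) * ((tB ν : ℚ) : ℚ_[2]) - 2 * ((tB (ν + 1) : ℚ) : ℚ_[2])‖
      = ‖(2 : ℚ_[2]) * (((tB ν : ℚ) : ℚ_[2]) - ((tB (ν + 1) : ℚ) : ℚ_[2]))‖ := by rw [mul_sub]
    _ = 1 / 2 * ‖((tB ν : ℚ) : ℚ_[2]) - ((tB (ν + 1) : ℚ) : ℚ_[2])‖ := by rw [norm_mul, h2]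
    _ ≤ 1 / 2 * (‖((tB ν : ℚ) : ℚ_[2])‖ + ‖((tB (ν + 1) : ℚ) : ℚ_[2])‖) := by
        gcongr; exact norm_sub_le _ _
    _ ≤ 1 / 2 * (((1 : ℝ) / 2) ^ (ν + 1) + ((1 : ℝ) / 2) ^ (ν + 2)) := by
        gcongr
        · exact norm_tB_le ν
        · exact norm_tB_le (ν + 1)
    _ ≤ ((1 : ℝ) / 2) ^ (ν + 1) := by
        rw [pow_succ, pow_succ, pow_succ]
        have : (0 : ℝ) ≤ ((1 : ℝ) / 2) ^ ν := by positivity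
        nlinarith

/-- The series `Σ_{ν≥1} t_ν/ν` is summable in `ℚ₂`. -/
theorem summable_tB_div_two_adic : Summable fun ν : ℕ => ((tB (ν + 1) / (ν + 1 : ℚ) : ℚ) : ℚ_[2]) := by
  refine NonarchimedeanAddGroup.summable_of_tendsto_cofinite_zero ?_
  rw [Nat.cofinite_eq_atTop, tendsto_zero_iff_norm_tendsto_zero]
  have hb : Tendsto (fun N : ℕ => ((1 : ℝ) / 2) ^ (N + 1)) atTop (nhds 0) := by
    have := (tendsto_pow_atTop_nhds_zero_of_lt_one (by norm_num : (0 : ℝ) ≤ 1 / 2) (by norm_num)).mul_const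
      ((1 : ℝ) / 2)
    simpa [pow_succ] using this
  exact squeeze_zero (fun N => norm_nonneg _) norm_tB_div_le hb

/-- **K5a's constant in `ℚ₂`:** `Σ_{ν≥1} t_ν/ν = 4` (2-adically). -/
theorem hasSum_tB_div_two_adic : HasSum (fun ν : ℕ => ((tB (ν + 1) / (ν + 1 : ℚ) : ℚ) : ℚ_[2])) 4 := by
  rw [summable_tB_div_two_adic.hasSum_iff_tendsto_nat]
  have hps : ∀ N : ℕ, ∑ i ∈ range N, ((tB (i + 1) / (i + 1 : ℚ) : ℚ) : ℚ_[2]) = ((4 - 2 * tB N : ℚ) : ℚ_[2]) := by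
    intro N
    rw [← tB_sum_div N]
    push_cast
    rfl
  simp_rw [hps]
  have h := tendsto_tB_two_adic.const_mul (2 : ℚ_[2])
  have h' := h.const_sub (4 : ℚ_[2])
  simp only [mul_zero, sub_zero] at h'
  refine h'.congr fun N => ?_
  push_cast
  ring

/-- Hence `Σ'_{ν} t_{ν+1}/(ν+1) = 4` in `ℚ₂`. -/
theorem tsum_tB_div_two_adic : ∑' ν : ℕ, ((tB (ν + 1) / (ν + 1 : ℚ) : ℚ) : ℚ_[2]) = 4 :=
  hasSum_tB_div_two_adic.tsum_eq

end Summit.KontsevichZagierPeriods.Zeta5Search.CatalanTwoAdicSeries
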